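import Literature.Analysis.FluidPDE.FluidComputer.ThresholdLevelTableA5
import HarnessLib

/-!
# Kernel run of the A = 5 level-table checker, chunks 20 … 23 (steps 500 … 599) (bp3 gen 13, layer 4)

HONEST FRAMING: low prior, high value-of-information experiment on Tao's machine paradigm; NOT a
claim that NS blows up.

Four kernel evaluations (`decide +kernel`; no `native_decide`, no extra axioms) of the checker
`runSteps` (`ThresholdLevelCheck.lean`) on 25 steps of `ThresholdLevelTableA5.stepsT` at a time, from
the entry box `Bc i` towards the next chunk's first level, returning the entry box `Bc (i+1)`
(≈ 30 s of kernel time per chunk; same scheme as `ThresholdLevelTableRun0 … 7` for A = 2).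
-/

namespace Literature.Analysis.FluidPDE.FluidComputer

namespace ThresholdLevelTableA5

set_option maxHeartbeats 10000000 in
set_option maxRecDepth 200000 in
/-- Chunk 20 of the A = 5 table run (steps 500 … 524). [folklore] -/
theorem run20 : runSteps 60 12 3 GIt RbIt Bc20 chunk20 1257388106562864 = some Bc21 := by
  decide +kernel

set_option maxHeartbeats 10000000 in
set_option maxRecDepth 200000 in
/-- Chunk 21 of the A = 5 table run (steps 525 … 549). [folklore] -/
theorem run21 : runSteps 60 12 3 GIt RbIt Bc21 chunk21 1376379965457503 = some Bc22 := by
  decide +kernel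

set_option maxHeartbeats 10000000 in
set_option maxRecDepth 200000 in
/-- Chunk 22 of the A = 5 table run (steps 550 … 574). [folklore] -/
theorem run22 : runSteps 60 12 3 GIt RbIt Bc22 chunk22 1506632518173961 = some Bc23 := by
  decide +kernel

set_option maxHeartbeats 10000000 in
set_option maxRecDepth 200000 in
/-- Chunk 23 of the A = 5 table run (steps 575 … 599). [folklore] -/
theorem run23 : runSteps 60 12 3 GIt RbIt Bc23 chunk23 1649211410938179 = some Bc24 := by
  decide +kernel

end ThresholdLevelTableA5

end Literature.Analysis.FluidPDE.FluidComputer
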